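/-
Copyright: public-domain mathematics; typed transcription for the H21 Literature library (cell lit-balaban,
reader/typer seat r02 gen 5 = literature-prover-lit-balaban-r02-g5-0).

statement-level skeleton of published theorems with citation tags; proofs where landed; nothing here is a claim about the Yang–Mills mass gap

# Bałaban, *Propagators and renormalization transformations for lattice gauge theories. I*,
# Commun. Math. Phys. **95** (1984) 17–40 — b04's torus kernel `K_T` of [B2] (2.48) SOLVES `(Δ + aQ′*Q′)u = Q′*ω`
# ON THE PRODUCT TORUS `T_η = Π_μ ℤ/(nM_μ)` (the Green identity behind «P = G′Q′*(Q′G′²Q′*)⁻¹Q′G′», p. 38)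

[cite: Balaban1984PropagatorsI]  T. Bałaban, Commun. Math. Phys. 95 (1984) 17–40.  p. 25, text after the integral display (1.42),
verbatim: «with a > 0 (we will take eventually a = 1), and let us denote Δ′_a = Δ + aQ′_k*Q′_k = Δ + aP′_k. The properties of this
operator were investigated in [2], its inverse is a bounded operator G′_k …»;
p. 38 ll. 7–10 (the G′-representation of P).  [cite: Balaban1983RegularityDecay] (2.44)/(2.48) pp.584–585.

WHAT THIS MODULE ADDS (SKELETON row B5.Prop1.2 census (vii), (1.132) kernel identification, memo step (2) second half):
`repZ` (integer representatives of torus points), `castU`, `KTvec a ω x := Σ_{y ∈ box} ω(y) K_T(repZ x, y)` and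
**`green_KTvec`**: `(LapS (fine n M) n + a•(QsAdj*QsOp)) *ᵥ KTvec a ω = QsAdj *ᵥ ω` — `B4TorusGreen244.torusGreen244_apply` read on the
torus through own dictionary `B5GreenBridgeP12Dict.opD_embS`.  (Injectivity of `Δ + aQ′*Q′`, a > 0, hence `KTvec = G′Q′*`, is next.)

HONEST SCOPE.  Bookkeeping; the analysis is b04's.

v1.1 (r02 gen 6, DOCFIX ONLY — referee ref-1 gen 29 erratum candidate on the sibling `B5GreenBridgeP12Dict`, same paraphrase here):
the v1 header wrote «p. 25 (1.42) G′_k = (Δ + a_kQ′_k*Q′_k)⁻¹»; in print (1.42) is the integral display, the constant is `a` (no subscript),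
and `Δ′_a`, `G′_k` are named in the prose after (1.42) (quoted above).  No declaration, statement or proof changed.
-/
import Mathlib
import Literature.MathematicalPhysics.QuantumFieldTheory.Balaban1983to89.B5GreenBridgeP12Dict
import Literature.MathematicalPhysics.QuantumFieldTheory.Balaban1983to89.B4TorusGreen244

open scoped BigOperators Matrix
open Finset Matrix

namespace Literature.MathematicalPhysics.QuantumFieldTheory.Balaban1983to89.B5GreenBridgeP12Green

open Literature.MathematicalPhysics.QuantumFieldTheory.Balaban1983to89
open Literature.MathematicalPhysics.QuantumFieldTheory.Balaban1983to89.B5Prop11Plancherel (Tor fine)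
open Literature.MathematicalPhysics.QuantumFieldTheory.Balaban1983to89.B4Green244 (coarse opD)
open Literature.MathematicalPhysics.QuantumFieldTheory.Balaban1983to89.B4TorusGreen244 (KT KT_translate_left torusGreen244_apply)
open Literature.MathematicalPhysics.QuantumFieldTheory.Balaban1983to89.B4TorusKernel (MultiPeriod.translate)
open Literature.MathematicalPhysics.QuantumFieldTheory.Balaban1983to89.B5Action121 (LapS)
open Literature.MathematicalPhysics.QuantumFieldTheory.Balaban1983to89.B5Block118 (QsOp)
open Literature.MathematicalPhysics.QuantumFieldTheory.Balaban1983to89.B5Hk160Torus (QsAdj)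
open Literature.MathematicalPhysics.QuantumFieldTheory.Balaban1983to89.B5Cube1Partition (blockLabel blockLabel_val)
open Literature.MathematicalPhysics.QuantumFieldTheory.Balaban1983to89.B5GreenBridgeP12Dict (castZ embS opD_embS QsAdj_mulVec)

noncomputable section

variable {d : ℕ} (n : ℕ) [NeZero n] (M : Fin (d + 1) → ℕ) [hM : ∀ μ, NeZero (M μ)]

/-! ## §1 Representatives and casts -/

/-- the integer representative `(x_ν.val)_ν ∈ Π_ν [0, nM_ν)` of a fine torus point. [cite: Balaban1984PropagatorsI, p.18] -/
def repZ (x : Tor (fine n M)) : Fin (d + 1) → ℤ := fun ν => ((x ν).val : ℤ)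

/-- an integer point read on the unit torus `T₁ = Π_μ ℤ/M_μ`. [cite: Balaban1984PropagatorsI, p.18] -/
def castU (y : Fin (d + 1) → ℤ) : Tor M := fun ν => ((y ν : ℤ) : ZMod (M ν))

omit hM in
/-- `castZ ∘ repZ = id`. [cite: Balaban1984PropagatorsI, p.18] -/
theorem castZ_repZ [hM : ∀ μ, NeZero (M μ)] (x : Tor (fine n M)) : castZ n M (repZ n M x) = x := by
  funext ν
  simp [castZ, repZ]

omit hM in
/-- `repZ (castZ z)` is a translate of `z` by the periods `(nM_ν)_ν`. [cite: Balaban1984PropagatorsI, p.18] -/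
theorem repZ_castZ [hM : ∀ μ, NeZero (M μ)] (z : Fin (d + 1) → ℤ) :
    repZ n M (castZ n M z) = MultiPeriod.translate (fun i => n * M i) z (fun i => -(z i / ((n : ℤ) * (M i : ℤ)))) := by
  funext ν
  simp only [repZ, castZ, B4TorusKernel.MultiPeriod.translate_apply, ZMod.val_intCast]
  have hN : ((fine n M ν : ℕ) : ℤ) = (n : ℤ) * (M ν : ℤ) := by simp [fine]
  rw [hN, Int.emod_def]
  ring

omit hM in
/-- `castU` is `(M_ν)_ν`-periodic. [cite: Balaban1984PropagatorsI, p.18] -/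
theorem castU_translate (y m : Fin (d + 1) → ℤ) :
    castU M (MultiPeriod.translate M y m) = castU M y := by
  funext ν
  simp [castU, B4TorusKernel.MultiPeriod.translate_apply]

omit hM in
/-- `castU (⌊repZ x / n⌋) = ⌊x/n⌋` (the block label). [cite: Balaban1984PropagatorsI, (1.6) p.18] -/
theorem castU_coarse_repZ [hM : ∀ μ, NeZero (M μ)] (x : Tor (fine n M)) : castU M (coarse n (repZ n M x)) = blockLabel M n x := by
  funext ν
  apply ZMod.val_injective
  rw [blockLabel_val]
  simp only [castU, coarse, repZ]
  rw [show ((x ν).val : ℤ) / (n : ℤ) = (((x ν).val / n : ℕ) : ℤ) by push_cast; rfl, Int.cast_natCast,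
    ZMod.val_natCast_of_lt (B5Cube1Partition.val_div_lt M n x ν)]

/-! ## §2 The `K_T`-vector and the Green identity on the torus -/

/-- **`(G′Q′*ω)(x)` in kernel form**: `Σ_{y ∈ Π[0,M_ν)} ω(y) K_T(repZ x, y)`. [cite: Balaban1984PropagatorsI, p.38 ll.7–10 (G′Q′*);
Balaban1983RegularityDecay (2.48) p.585] -/
def KTvec (a : ℝ) (ω : Tor M → ℂ) (x : Tor (fine n M)) : ℂ :=
  ∑ y ∈ Fintype.piFinset (fun i => Finset.Ico (0 : ℤ) (M i)), ω (castU M y) * KT n a 0 M (repZ n M x) y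

omit hM in
/-- the periodic extension of `KTvec` IS b04's function `z ↦ Σ_y ω(y) K_T(z, y)`. [cite: Balaban1983RegularityDecay, (2.48) p.585] -/
theorem embS_KTvec [hM : ∀ μ, NeZero (M μ)] (a : ℝ) (ω : Tor M → ℂ) (z : Fin (d + 1) → ℤ) :
    embS n M (KTvec n M a ω) z
      = ∑ y ∈ Fintype.piFinset (fun i => Finset.Ico (0 : ℤ) (M i)), ω (castU M y) * KT n a 0 M z y := by
  have hM1 : ∀ i, 1 ≤ M i := fun i => Nat.one_le_iff_ne_zero.mpr (NeZero.ne (M i))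
  unfold embS KTvec
  refine Finset.sum_congr rfl fun y _ => ?_
  rw [repZ_castZ, KT_translate_left n a 0 hM1]

omit hM in
/-- **THE GREEN IDENTITY ON THE PRODUCT TORUS**: `(Δ + aQ′*Q′)·(K_T ω) = Q′*ω` — b04's `torusGreen244_apply` (m² = 0) read through the
dictionary `opD_embS`. [cite: Balaban1984PropagatorsI, p.25 text after (1.42), p.38 ll.7–10] [cite: Balaban1983RegularityDecay, (2.44) p.584] -/
theorem green_KTvec [hM : ∀ μ, NeZero (M μ)] (hn : 1 ≤ n) {a : ℝ} (ha : 0 < a) (ω : Tor M → ℂ) :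
    (LapS (fine n M) (n : ℂ) + (a : ℂ) • (QsAdj n M * QsOp n M)) *ᵥ KTvec n M a ω = QsAdj n M *ᵥ ω := by
  have hM1 : ∀ i, 1 ≤ M i := fun i => Nat.one_le_iff_ne_zero.mpr (NeZero.ne (M i))
  funext x
  have hg : ∀ y m, (fun y => ω (castU M y)) (MultiPeriod.translate M y m) = (fun y => ω (castU M y)) y := fun y m => by
    simp only [castU_translate]
  have h := torusGreen244_apply n hn a 0 ha le_rfl hM1 (fun y => ω (castU M y)) hg (repZ n M x)
  have he : (fun z' => ∑ y ∈ Fintype.piFinset (fun i => Finset.Ico (0 : ℤ) (M i)), ω (castU M y) * KT n a 0 M z' y)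
      = embS n M (KTvec n M a ω) := by
    funext z'; exact (embS_KTvec n M a ω z').symm
  rw [he, opD_embS, embS, castZ_repZ, castU_coarse_repZ] at h
  rw [h, QsAdj_mulVec]

end

end Literature.MathematicalPhysics.QuantumFieldTheory.Balaban1983to89.B5GreenBridgeP12Green
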